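import Summits.Ventures.WeilGRH.TwistedPrimeFormBound
import Summits.Ventures.WeilGRH.TwistedArchFarModes
import HarnessLib

/-!
# GRH arm (rh-explicit, venture WeilGRH): far coercivity (L-C3a) for a COMPLEX character — the hermitian kernel
  `twistedGramCoeffC χ a` is `⪰ diag(2e⁻ − A_op⁺ + log q)` on the far modes

Cell `rh-explicit`, WEIL TRACK — GRH ARM (lit/typing seat weil-grh-5 gen11).  For ANY Dirichlet character χ mod q the Gram
kernel of the even-parity twisted window form on Yoshida's basis is the hermitian `twistedGramCoeffC χ a`
(`TwistedGramEvenComplex.lean`; door `weilPositivityOnChar_of_twistedGramCoeffC_realify_any`, either parity).  Here: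

* `re_twistedPrimeC_form_ge` — the PRIME part (Yoshida's `primeCoeff` plus the complex correction
  `Σ_k Λ_k k^{−1/2}[(1 − χ(k))P_k(m,n) + conj((1 − χ(k))P_k(n,m))]`) has real quadratic form
  `Σ_k Λ_k k^{−1/2}·(−2 Re(χ(k)·∫f(x+log k) conj f(x)dx))`, hence is `≥ −A_op⁺(a)·Σ|c_n|²` on every finite set of modes — by the
  MODULUS shift bound `two_mul_norm_integral_shift_mul_conj_le` (`TwistedPrimeFormBound.lean`) and `|χ(k)| ≤ 1`;
* `re_twistedGramCoeffC_modes_far_ge` — for `c : ℤ → ℂ` supported on `B ≤ |p| ≤ N` (`2 ≤ B`):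
  `Σ_{p∈modes N} (2e⁻_B(|p|) − A_op⁺(a) + log q)‖c_p‖² ≤ Re Σ_{p,q∈modes N} conj(c_p) c_q twistedGramCoeffC χ a p q`,
  `e⁻_B` the odd-sector archimedean weight of `TwistedArchFarModes.lean` (block `M₁ = B − 1`).

In the orthonormal basis `χ_n` this is the far-block bound `G^C_far ⪰ diag(d̂_W)` with `d̂_W(n) = 2·d̂⁻_χ(n)` (M-units of
`TwistedFarAssembly.lean` × 2), uniform in the truncation — the `hfar` input of a format-C certificate for a complex
character in whatever (mode, re/im) indexing the eventual ∀N door adopts.  Standard axioms; no definitions; no named facts;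
RH/GRH-free.
-/

set_option autoImplicit false

noncomputable section

open Complex Set MeasureTheory Finset
open scoped Real ComplexConjugate BigOperators ArithmeticFunction.vonMangoldt

namespace Summit.Ventures.WeilGRH

open Literature.NumberTheory.LFunctions
open Literature.NumberTheory.LFunctions.Yoshida1992 (modes chi freq gramCoeff polarCoeff incrCoeff primeCoeff archCoeff)
open Literature.Analysis.SpecialFunctions
open Summit.RiemannHypothesis.RiemannHypothesis.Theorems.WeilFormatC

variable {q : ℕ} {a : ℝ}

/-! ## The complex prime block -/

section Prime

/-- One length: the complex correction's form is `(1−χ)J + conj((1−χ)J)`, `J = ∫ f(x+t) conj f(x)`, `f = Σ c_nχ_n`. -/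
theorem sum_sum_conj_mul_shiftCorrection_eq (ha : 0 < a) (w : ℂ) (s : Finset ℤ) (c : ℤ → ℂ) {t : ℝ} (ht0 : 0 ≤ t)
    (ht : t ≤ 2 * a) :
    ∑ n ∈ s, ∑ m ∈ s, conj (c n) * c m * (w * shiftCoeff a t m n + conj (w * shiftCoeff a t n m))
      = w * (∫ x, (∑ n ∈ s, c n • chi a n) (x + t) * conj ((∑ n ∈ s, c n • chi a n) x))
        + conj (w * ∫ x, (∑ n ∈ s, c n • chi a n) (x + t) * conj ((∑ n ∈ s, c n • chi a n) x)) := by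
  set J := ∫ x, (∑ n ∈ s, c n • chi a n) (x + t) * conj ((∑ n ∈ s, c n • chi a n) x) with hJ
  have hJ1 : J = ∑ m ∈ s, ∑ n ∈ s, c m * conj (c n) * shiftCoeff a t m n :=
    integral_shift_mul_conj_sum_smul_chi ha s c ht0 ht
  have h1 : ∑ n ∈ s, ∑ m ∈ s, conj (c n) * c m * (w * shiftCoeff a t m n) = w * J := by
    rw [hJ1, Finset.mul_sum, Finset.sum_comm]
    refine Finset.sum_congr rfl fun m _ ↦ ?_
    rw [Finset.mul_sum]
    exact Finset.sum_congr rfl fun n _ ↦ by ring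
  have h2 : ∑ n ∈ s, ∑ m ∈ s, conj (c n) * c m * conj (w * shiftCoeff a t n m) = conj (w * J) := by
    rw [hJ1, Finset.mul_sum, map_sum]
    refine Finset.sum_congr rfl fun n _ ↦ ?_
    rw [Finset.mul_sum, map_sum]
    refine Finset.sum_congr rfl fun m _ ↦ ?_
    simp only [map_mul, Complex.conj_conj]
    ring
  simp only [mul_add, Finset.sum_add_distrib]
  rw [h1, h2]

/-- **The complex prime block is `⪰ −A_op⁺·1`.**  For `a > 0`, any character χ, every finite `s ⊆ ℤ` and `c : ℤ → ℂ`: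
`−A_op⁺(a)·Σ|c_n|² ≤ Σ Re(conj c_n c_m)·primeCoeff a n m + Re Σ conj(c_n) c_m Σ_k Λ_k k^{−1/2}[(1 − χ(k))P_k(m,n) + conj((1 − χ(k))P_k(n,m))]`. -/
theorem re_twistedPrimeC_form_ge (χ : DirichletCharacter ℂ q) (ha : 0 < a) (s : Finset ℤ) (c : ℤ → ℂ) :
    -((∑ k ∈ weilPrimeIndex a, (Λ k : ℝ) / Real.sqrt k * (2 * Real.cos (π / (⌊2 * a / Real.log k⌋₊ + 2)))) *
        ∑ n ∈ s, ‖c n‖ ^ 2)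
      ≤ (∑ n ∈ s, ∑ m ∈ s, (conj (c n) * c m).re * primeCoeff a n m)
        + (∑ n ∈ s, ∑ m ∈ s, conj (c n) * c m *
            ∑ k ∈ weilPrimeIndex a, (((Λ k : ℝ) / Real.sqrt k : ℝ) : ℂ) *
              ((1 - χ (k : ZMod q)) * shiftCoeff a (Real.log k) m n +
                conj ((1 - χ (k : ZMod q)) * shiftCoeff a (Real.log k) n m))).re := by
  set f := ∑ n ∈ s, c n • chi a n with hf
  have hfw : IsWindowFunction a f := IsWindowFunction.sum s c fun n _ ↦ isWindowFunction_chi ha n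
  set J : ℕ → ℂ := fun k ↦ ∫ x, f (x + Real.log k) * conj (f x) with hJ
  -- the prime coefficient, length by length
  have hprime : ∑ n ∈ s, ∑ m ∈ s, (conj (c n) * c m).re * primeCoeff a n m
      = ∑ k ∈ weilPrimeIndex a, (Λ k : ℝ) / Real.sqrt k * (-2 * (J k).re) := by
    calc ∑ n ∈ s, ∑ m ∈ s, (conj (c n) * c m).re * primeCoeff a n m
        = ∑ n ∈ s, ∑ m ∈ s, ∑ k ∈ weilPrimeIndex a, (Λ k : ℝ) / Real.sqrt k *
            ((conj (c n) * c m).re * (incrCoeff a (Real.log k) n m - if n = m then 2 else 0)) := by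
          refine Finset.sum_congr rfl fun n _ ↦ Finset.sum_congr rfl fun m _ ↦ ?_
          rw [Yoshida1992.primeCoeff, Finset.mul_sum]
          refine Finset.sum_congr rfl fun k _ ↦ by ring
      _ = ∑ n ∈ s, ∑ k ∈ weilPrimeIndex a, ∑ m ∈ s, (Λ k : ℝ) / Real.sqrt k *
            ((conj (c n) * c m).re * (incrCoeff a (Real.log k) n m - if n = m then 2 else 0)) :=
          Finset.sum_congr rfl fun n _ ↦ Finset.sum_comm
      _ = ∑ k ∈ weilPrimeIndex a, ∑ n ∈ s, ∑ m ∈ s, (Λ k : ℝ) / Real.sqrt k *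
            ((conj (c n) * c m).re * (incrCoeff a (Real.log k) n m - if n = m then 2 else 0)) :=
          Finset.sum_comm
      _ = ∑ k ∈ weilPrimeIndex a, (Λ k : ℝ) / Real.sqrt k *
            ∑ n ∈ s, ∑ m ∈ s, (conj (c n) * c m).re * (incrCoeff a (Real.log k) n m - if n = m then 2 else 0) := by
          refine Finset.sum_congr rfl fun k _ ↦ ?_
          rw [Finset.mul_sum]
          refine Finset.sum_congr rfl fun n _ ↦ ?_
          rw [Finset.mul_sum]
      _ = _ := by
          refine Finset.sum_congr rfl fun k hk ↦ ?_
          have ht2 : Real.log k ≤ 2 * a := (mem_weilPrimeIndex.1 hk).le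
          rw [sum_sum_re_mul_incrCoeff_sub_two_eq ha s c (Real.log_natCast_nonneg k) ht2]
  -- the complex correction, length by length
  have hcorr : ∑ n ∈ s, ∑ m ∈ s, conj (c n) * c m *
        ∑ k ∈ weilPrimeIndex a, (((Λ k : ℝ) / Real.sqrt k : ℝ) : ℂ) *
          ((1 - χ (k : ZMod q)) * shiftCoeff a (Real.log k) m n + conj ((1 - χ (k : ZMod q)) * shiftCoeff a (Real.log k) n m))
      = ∑ k ∈ weilPrimeIndex a, (((Λ k : ℝ) / Real.sqrt k : ℝ) : ℂ) *
          ((1 - χ (k : ZMod q)) * J k + conj ((1 - χ (k : ZMod q)) * J k)) := by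
    calc ∑ n ∈ s, ∑ m ∈ s, conj (c n) * c m *
          ∑ k ∈ weilPrimeIndex a, (((Λ k : ℝ) / Real.sqrt k : ℝ) : ℂ) *
            ((1 - χ (k : ZMod q)) * shiftCoeff a (Real.log k) m n + conj ((1 - χ (k : ZMod q)) * shiftCoeff a (Real.log k) n m))
        = ∑ n ∈ s, ∑ m ∈ s, ∑ k ∈ weilPrimeIndex a, (((Λ k : ℝ) / Real.sqrt k : ℝ) : ℂ) *
            (conj (c n) * c m * ((1 - χ (k : ZMod q)) * shiftCoeff a (Real.log k) m n +
              conj ((1 - χ (k : ZMod q)) * shiftCoeff a (Real.log k) n m))) := by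
          refine Finset.sum_congr rfl fun n _ ↦ Finset.sum_congr rfl fun m _ ↦ ?_
          rw [Finset.mul_sum]
          refine Finset.sum_congr rfl fun k _ ↦ by ring
      _ = ∑ n ∈ s, ∑ k ∈ weilPrimeIndex a, ∑ m ∈ s, (((Λ k : ℝ) / Real.sqrt k : ℝ) : ℂ) *
            (conj (c n) * c m * ((1 - χ (k : ZMod q)) * shiftCoeff a (Real.log k) m n +
              conj ((1 - χ (k : ZMod q)) * shiftCoeff a (Real.log k) n m))) :=
          Finset.sum_congr rfl fun n _ ↦ Finset.sum_comm
      _ = ∑ k ∈ weilPrimeIndex a, ∑ n ∈ s, ∑ m ∈ s, (((Λ k : ℝ) / Real.sqrt k : ℝ) : ℂ) *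
            (conj (c n) * c m * ((1 - χ (k : ZMod q)) * shiftCoeff a (Real.log k) m n +
              conj ((1 - χ (k : ZMod q)) * shiftCoeff a (Real.log k) n m))) :=
          Finset.sum_comm
      _ = ∑ k ∈ weilPrimeIndex a, (((Λ k : ℝ) / Real.sqrt k : ℝ) : ℂ) *
            ∑ n ∈ s, ∑ m ∈ s, conj (c n) * c m * ((1 - χ (k : ZMod q)) * shiftCoeff a (Real.log k) m n +
              conj ((1 - χ (k : ZMod q)) * shiftCoeff a (Real.log k) n m)) := by
          refine Finset.sum_congr rfl fun k _ ↦ ?_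
          rw [Finset.mul_sum]
          refine Finset.sum_congr rfl fun n _ ↦ ?_
          rw [Finset.mul_sum]
      _ = _ := by
          refine Finset.sum_congr rfl fun k hk ↦ ?_
          have ht2 : Real.log k ≤ 2 * a := (mem_weilPrimeIndex.1 hk).le
          rw [sum_sum_conj_mul_shiftCorrection_eq ha _ s c (Real.log_natCast_nonneg k) ht2]
  rw [hprime, hcorr, Complex.re_sum, ← Finset.sum_add_distrib, Finset.sum_mul, ← Finset.sum_neg_distrib]
  refine Finset.sum_le_sum fun k hk ↦ ?_
  -- per length: the two pieces combine to `−2 Re(χ(k) J_k)`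
  have hwk : 0 ≤ (Λ k : ℝ) / Real.sqrt k := div_nonneg ArithmeticFunction.vonMangoldt_nonneg (Real.sqrt_nonneg _)
  have hre : ((((Λ k : ℝ) / Real.sqrt k : ℝ) : ℂ) *
      ((1 - χ (k : ZMod q)) * J k + conj ((1 - χ (k : ZMod q)) * J k))).re
        = (Λ k : ℝ) / Real.sqrt k * (2 * (J k).re - 2 * (χ (k : ZMod q) * J k).re) := by
    rw [Complex.re_ofReal_mul, Complex.add_re, Complex.conj_re, sub_mul, one_mul, Complex.sub_re]
    ring
  rw [hre]
  have hcomb : (Λ k : ℝ) / Real.sqrt k * (-2 * (J k).re)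
      + (Λ k : ℝ) / Real.sqrt k * (2 * (J k).re - 2 * (χ (k : ZMod q) * J k).re)
      = (Λ k : ℝ) / Real.sqrt k * (-2 * (χ (k : ZMod q) * J k).re) := by ring
  rw [hcomb]
  -- `|2 Re(χ J)| ≤ 2‖J‖ ≤ 2cos·Σ‖c‖²`
  by_cases hΛ : (Λ k : ℝ) = 0
  · rw [hΛ]; simp
  have hk2 : 2 ≤ k := by
    by_contra h
    have : k = 0 ∨ k = 1 := by omega
    rcases this with rfl | rfl
    · exact hΛ (by simp)
    · exact hΛ (by simp)
  have ht : 0 < Real.log k := Real.log_pos (by exact_mod_cast hk2)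
  set N : ℕ := ⌊2 * a / Real.log k⌋₊ + 1 with hN
  have hN1 : 1 ≤ N := by omega
  have hNt : 2 * a < N * Real.log k := by
    have h := Nat.lt_floor_add_one (2 * a / Real.log k)
    rw [div_lt_iff₀ ht] at h
    exact_mod_cast h
  have hb := two_mul_norm_integral_shift_mul_conj_le ha.le hfw ht hN1 hNt
  rw [hf, integral_norm_sq_sum_smul_chi ha s c] at hb
  have hcast : ((N : ℝ) + 1) = (⌊2 * a / Real.log k⌋₊ : ℝ) + 2 := by rw [hN]; push_cast; ring
  rw [hcast] at hb
  have hJb : 2 * ‖J k‖ ≤ 2 * Real.cos (π / (⌊2 * a / Real.log k⌋₊ + 2)) * ∑ n ∈ s, ‖c n‖ ^ 2 := by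
    simpa only [hJ, hf] using hb
  have hreJ : |(χ (k : ZMod q) * J k).re| ≤ ‖J k‖ :=
    (Complex.abs_re_le_norm _).trans (by
      rw [norm_mul]
      exact mul_le_of_le_one_left (norm_nonneg _) (DirichletCharacter.norm_le_one χ _))
  have h2 : -(2 * Real.cos (π / (⌊2 * a / Real.log k⌋₊ + 2)) * ∑ n ∈ s, ‖c n‖ ^ 2)
      ≤ -2 * (χ (k : ZMod q) * J k).re := by
    have := (abs_le.mp hreJ).2
    linarith
  have := mul_le_mul_of_nonneg_left h2 hwk
  linarith

end Prime

/-! ## The hermitian kernel on the far modes -/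

section Far

/-- **Far coercivity for a complex character (L-C3a at the level of modes).**  For `a > 0`, any χ mod `q`, `2 ≤ B` and
`c : ℤ → ℂ` supported on `B ≤ |p| ≤ N`:
`Σ_{p∈modes N} (2e⁻_B(|p|) − A_op⁺(a) + log q)‖c_p‖² ≤ Re Σ_{p,q∈modes N} conj(c_p) c_q twistedGramCoeffC χ a p q`. -/
theorem re_twistedGramCoeffC_modes_far_ge (χ : DirichletCharacter ℂ q) (ha : 0 < a) {B : ℕ} (hB : 2 ≤ B) (N : ℕ)
    (c : ℤ → ℂ) (hcB : ∀ p : ℤ, p.natAbs < B → c p = 0) (hcN : ∀ p : ℤ, N < p.natAbs → c p = 0) :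
    ∑ p ∈ modes N, (2 * ((reDigammaQuarter (freq a p.natAbs) - Real.log π) / 2 - 1 / (8 * (p.natAbs : ℝ))
          - a * (1 + weilArchDensity (2 * a)) / (π ^ 2 * (p.natAbs : ℝ) ^ 2)
          - (π / 2 - Real.arctan (Real.sqrt ((B - 1 : ℕ) : ℝ) / Real.sqrt (p.natAbs : ℝ))) / 2
          - a * (1 + weilArchDensity (2 * a)) / π ^ 2 * Real.sqrt (8 / ((B - 1 : ℕ) : ℝ)))
        - (∑ k ∈ weilPrimeIndex a, (Λ k : ℝ) / Real.sqrt k * (2 * Real.cos (π / (⌊2 * a / Real.log k⌋₊ + 2))))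
        + Real.log q) * ‖c p‖ ^ 2
      ≤ (∑ p ∈ modes N, ∑ p' ∈ modes N, conj (c p) * c p' * twistedGramCoeffC χ a p p').re := by
  set Aop := ∑ k ∈ weilPrimeIndex a, (Λ k : ℝ) / Real.sqrt k * (2 * Real.cos (π / (⌊2 * a / Real.log k⌋₊ + 2)))
    with hAop
  -- split the kernel: real part (prime + arch + conductor) + complex correction
  have hsplit : ∀ p p' : ℤ, conj (c p) * c p' * twistedGramCoeffC χ a p p'
      = conj (c p) * c p' * ((primeCoeff a p p' : ℝ) : ℂ)
        + conj (c p) * c p' * ((archCoeff a p p' : ℝ) : ℂ)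
        + conj (c p) * c p' * ((if p = p' then Real.log q else 0 : ℝ) : ℂ)
        + conj (c p) * c p' * ∑ k ∈ weilPrimeIndex a, (((Λ k : ℝ) / Real.sqrt k : ℝ) : ℂ) *
            ((1 - χ (k : ZMod q)) * shiftCoeff a (Real.log k) p' p +
              conj ((1 - χ (k : ZMod q)) * shiftCoeff a (Real.log k) p p')) := by
    intro p p'
    unfold twistedGramCoeffC
    rw [Yoshida1992.gramCoeff]
    push_cast
    ring
  have hform : (∑ p ∈ modes N, ∑ p' ∈ modes N, conj (c p) * c p' * twistedGramCoeffC χ a p p').re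
      = (∑ p ∈ modes N, ∑ p' ∈ modes N, (conj (c p) * c p').re * primeCoeff a p p')
        + (∑ p ∈ modes N, ∑ p' ∈ modes N, conj (c p) * c p' * ((archCoeff a p p' : ℝ) : ℂ)).re
        + (∑ p ∈ modes N, ∑ p' ∈ modes N, (conj (c p) * c p').re * (if p = p' then Real.log q else 0))
        + (∑ p ∈ modes N, ∑ p' ∈ modes N, conj (c p) * c p' *
            ∑ k ∈ weilPrimeIndex a, (((Λ k : ℝ) / Real.sqrt k : ℝ) : ℂ) *
              ((1 - χ (k : ZMod q)) * shiftCoeff a (Real.log k) p' p +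
                conj ((1 - χ (k : ZMod q)) * shiftCoeff a (Real.log k) p p'))).re := by
    simp_rw [hsplit, Finset.sum_add_distrib, Complex.add_re, Complex.re_sum, Complex.re_mul_ofReal]
  -- conductor: `Σ Re(conj c c')·(log q)δ = log q Σ‖c‖²`
  have hcond : ∑ p ∈ modes N, ∑ p' ∈ modes N, (conj (c p) * c p').re * (if p = p' then Real.log q else 0)
      = Real.log q * ∑ p ∈ modes N, ‖c p‖ ^ 2 := by
    rw [Finset.mul_sum]
    refine Finset.sum_congr rfl fun p hp ↦ ?_
    rw [Finset.sum_eq_single_of_mem p hp (fun p' _ hp' ↦ by rw [if_neg (Ne.symm hp'), mul_zero]), if_pos rfl,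
      Complex.conj_mul', ← Complex.ofReal_pow, Complex.ofReal_re]
    ring
  have hpri := re_twistedPrimeC_form_ge χ ha (modes N) c
  have harch := re_archCoeff_modes_far_ge ha hB N c hcB hcN
  rw [hform, hcond]
  have hlhs : ∑ p ∈ modes N, (2 * ((reDigammaQuarter (freq a p.natAbs) - Real.log π) / 2 - 1 / (8 * (p.natAbs : ℝ))
          - a * (1 + weilArchDensity (2 * a)) / (π ^ 2 * (p.natAbs : ℝ) ^ 2)
          - (π / 2 - Real.arctan (Real.sqrt ((B - 1 : ℕ) : ℝ) / Real.sqrt (p.natAbs : ℝ))) / 2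
          - a * (1 + weilArchDensity (2 * a)) / π ^ 2 * Real.sqrt (8 / ((B - 1 : ℕ) : ℝ)))
        - Aop + Real.log q) * ‖c p‖ ^ 2
      = -(Aop * ∑ p ∈ modes N, ‖c p‖ ^ 2)
        + ∑ p ∈ modes N, 2 * ((reDigammaQuarter (freq a p.natAbs) - Real.log π) / 2 - 1 / (8 * (p.natAbs : ℝ))
          - a * (1 + weilArchDensity (2 * a)) / (π ^ 2 * (p.natAbs : ℝ) ^ 2)
          - (π / 2 - Real.arctan (Real.sqrt ((B - 1 : ℕ) : ℝ) / Real.sqrt (p.natAbs : ℝ))) / 2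
          - a * (1 + weilArchDensity (2 * a)) / π ^ 2 * Real.sqrt (8 / ((B - 1 : ℕ) : ℝ))) * ‖c p‖ ^ 2
        + Real.log q * ∑ p ∈ modes N, ‖c p‖ ^ 2 := by
    rw [Finset.mul_sum, Finset.mul_sum, ← Finset.sum_neg_distrib, ← Finset.sum_add_distrib, ← Finset.sum_add_distrib]
    exact Finset.sum_congr rfl fun p _ ↦ by ring
  rw [hlhs]
  linarith

end Far

end Summit.Ventures.WeilGRH

end
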